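import Literature.Analysis.FluidPDE.WholeSpaceIBP
import Literature.Analysis.FluidPDE.NewtonPotential
import HarnessLib

/-!
# Weighted integrals of `ΔU`, `U`, `(y·∇)U`, `(U·∇)U` against a test function: bounds by `∫|U|`

Analysis/FluidPDE support file (theorems only) for the decomposition of the named fact
`Literature.Analysis.FluidPDE.tsai1998_lemma32` (Tsai 1998, Lemma 3.2). In the local control of
the pressure `P` of a Leray profile (`FluidPDE/TsaiLocalPressure`) the gradient of the harmonic
part of `P` at a point is a weighted average `∫ λ(z) ∂ₐP(y − z) dz`, and
`∇P = νΔU − aU − a(y·∇)U − (U·∇)U` by Leray's system; moving every derivative onto the smooth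
compactly supported weight bounds these four integrals by **`L¹`/`L²` norms of `U` on the support
of the weight, with no derivative of `U`** — the mechanism by which a *global* `L^q` bound on `U`
becomes a *local* bound on `∇P` up to harmonic corrections (this replaces the Calderón–Zygmund /
BMO–`H¹` Liouville argument of Tsai's Lemma 2.1, pp. 35–36, by its local counterpart).

For a finite-dimensional real inner product space `E`, a weight `Ψ ∈ C²_c(E)` supported in a
measurable set `S`, with `|Ψ| ≤ M₀`, `‖DΨ‖ ≤ M₁`, `|ΔΨ| ≤ M₂`, a field `U ∈ C²(E; E)` and a
vector `a`:

* `abs_integral_weight_mul_inner_laplacian_le`: `|∫ Ψ ⟪ΔU, a⟫| ≤ ‖a‖ M₂ ∫_S ‖U‖` (Green's second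
  identity `∫ Ψ ΔF = ∫ ΔΨ F`);
* `abs_integral_weight_mul_inner_le`: `|∫ Ψ ⟪U, a⟫| ≤ ‖a‖ M₀ ∫_S ‖U‖`;
* `abs_integral_weight_mul_inner_fderiv_apply_self_le`: `|∫ Ψ ⟪DU(w) w, a⟫ dw| ≤
  ‖a‖ (M₁ R + n M₀) ∫_S ‖U‖` if `‖w‖ ≤ R` on `S`, `n = dim E` (the trilinear identity with the
  vector field `w ↦ w`, whose divergence is `n`);
* `abs_integral_weight_mul_inner_convect_le`: for divergence-free `U`,
  `|∫ Ψ ⟪(U·∇)U, a⟫| ≤ ‖a‖ M₁ ∫_S ‖U‖²` (the trilinear identity `∫⟪(U·∇)U, W⟫ = −∫⟪U, (U·∇)W⟫`).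

All four are instances of the tree's whole-space integration by parts
(`FluidPDE/WholeSpaceIBP`: `integral_inner_convect_add_eq_zero`, `integral_inner_laplacian_comm`).
Everything is proved; no definitions, no named facts.

## References

* T.-P. Tsai, *On Leray's self-similar solutions of the Navier–Stokes equations satisfying local
  energy estimates*, Arch. Rational Mech. Anal. 143 (1998), proof of Lemma 2.1, pp. 35–36 (the
  terms `∫ (y·∇)U ε^{3+|α|} D^αφ(εy) dy` and `∫ ∇P̃ …` handled by moving derivatives onto the
  test function) [Tsai1998].
* J. Leray, *Sur le mouvement d'un liquide visqueux emplissant l'espace*, Acta Math. 63 (1934),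
  §6 (1.11) (integration by parts without boundary) [Leray1934].
-/

noncomputable section

open MeasureTheory Set Function Filter Topology InnerProductSpace Metric
open scoped RealInnerProductSpace Laplacian ContDiff

namespace Literature.Analysis.FluidPDE

section Weighted

variable {E : Type*} [NormedAddCommGroup E] [InnerProductSpace ℝ E] [FiniteDimensional ℝ E]
  [MeasurableSpace E] [BorelSpace E]

/-- A pointwise-dominated compactly supported integrand: if `|f| ≤ C g` on `S`, `f = 0` off `S`,
and `g` is integrable on `S`, then `|∫ f| ≤ C ∫_S g`. [folklore] -/
theorem abs_integral_le_of_support_subset {f g : E → ℝ} {S : Set E} (hS : MeasurableSet S)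
    {C : ℝ} (hfS : ∀ w ∉ S, f w = 0) (hle : ∀ w ∈ S, |f w| ≤ C * g w)
    (hg : IntegrableOn g S) : |∫ w, f w| ≤ C * ∫ w in S, g w := by
  have hdom : ∀ w, ‖f w‖ ≤ S.indicator (fun w => C * g w) w := fun w => by
    by_cases hw : w ∈ S
    · rw [indicator_of_mem hw, Real.norm_eq_abs]; exact hle w hw
    · rw [indicator_of_notMem hw, hfS w hw, norm_zero]
  calc |∫ w, f w| ≤ ∫ w, ‖f w‖ := by
        rw [← Real.norm_eq_abs]; exact norm_integral_le_integral_norm _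
    _ ≤ ∫ w, S.indicator (fun w => C * g w) w := by
        refine integral_mono_of_nonneg (Eventually.of_forall fun w => norm_nonneg _) ?_
          (Eventually.of_forall hdom)
        exact IntegrableOn.integrable_indicator
          (show IntegrableOn (fun w => C * g w) S volume from hg.const_mul C) hS
    _ = C * ∫ w in S, g w := by rw [integral_indicator hS, integral_const_mul]

variable {Ψ : E → ℝ} {U : E → E} {S : Set E} {a : E}

/-- **`|∫ Ψ ⟪U, a⟫| ≤ ‖a‖ M₀ ∫_S ‖U‖`** for a weight `|Ψ| ≤ M₀` supported in `S`. [folklore] -/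
theorem abs_integral_weight_mul_inner_le (hS : MeasurableSet S) (hΨS : tsupport Ψ ⊆ S) {M₀ : ℝ}
    (hM₀ : 0 ≤ M₀) (hΨ : ∀ w, |Ψ w| ≤ M₀) (hUS : IntegrableOn (fun w => ‖U w‖) S)
    (a : E) : |∫ w, Ψ w * ⟪U w, a⟫| ≤ ‖a‖ * M₀ * ∫ w in S, ‖U w‖ := by
  refine abs_integral_le_of_support_subset hS
    (fun w hw => by rw [image_eq_zero_of_notMem_tsupport fun h => hw (hΨS h), zero_mul])
    (fun w _ => ?_) hUS
  rw [abs_mul]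
  calc |Ψ w| * |⟪U w, a⟫| ≤ M₀ * (‖U w‖ * ‖a‖) :=
        mul_le_mul (hΨ w) (abs_real_inner_le_norm _ _) (abs_nonneg _) hM₀
    _ = ‖a‖ * M₀ * ‖U w‖ := by ring

omit [MeasurableSpace E] [BorelSpace E] in
/-- The Laplacian of `w ↦ Ψ(w) • a` for a fixed vector `a` is `ΔΨ • a`. [folklore] -/
private theorem laplacian_weight_smul_const {Ψ : E → ℝ} (hΨ : ContDiff ℝ 2 Ψ) (a : E) (w : E) :
    (Δ (fun w => Ψ w • a)) w = (Δ Ψ) w • a := by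
  let l : ℝ →L[ℝ] E := ContinuousLinearMap.smulRight (1 : ℝ →L[ℝ] ℝ) a
  have hl : ∀ t : ℝ, l t = t • a := fun t => by
    show ContinuousLinearMap.smulRight (1 : ℝ →L[ℝ] ℝ) a t = t • a
    rw [ContinuousLinearMap.smulRight_apply]
    rfl
  have h1 : (fun w => Ψ w • a) = l ∘ Ψ := by
    funext w
    exact (hl (Ψ w)).symm
  rw [h1, (hΨ.contDiffAt (x := w)).laplacian_CLM_comp_left, Function.comp_apply, hl]

/-- **`|∫ Ψ ⟪ΔU, a⟫| ≤ ‖a‖ M₂ ∫_S ‖U‖`** for `Ψ ∈ C²_c` with `|ΔΨ| ≤ M₂`, supported in `S`,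
and `U ∈ C²` (Green's second identity `∫ ⟪ΔU, Ψa⟫ = ∫ ⟪U, ΔΨ a⟫`). [folklore] -/
theorem abs_integral_weight_mul_inner_laplacian_le (hS : MeasurableSet S) (hΨ : ContDiff ℝ 2 Ψ)
    (hΨc : HasCompactSupport Ψ) (hΨS : tsupport Ψ ⊆ S) {M₂ : ℝ} (hM₂ : 0 ≤ M₂)
    (hΔΨ : ∀ w, |(Δ Ψ) w| ≤ M₂) (hU : ContDiff ℝ 2 U) (hUS : IntegrableOn (fun w => ‖U w‖) S)
    (a : E) : |∫ w, Ψ w * ⟪(Δ U) w, a⟫| ≤ ‖a‖ * M₂ * ∫ w in S, ‖U w‖ := by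
  have hW : ContDiff ℝ 2 fun w => Ψ w • a := hΨ.smul contDiff_const
  have hWc : HasCompactSupport fun w => Ψ w • a := hΨc.smul_right (f' := fun _ : E => a)
  have hcomm : ∫ w, Ψ w * ⟪(Δ U) w, a⟫ = ∫ w, (Δ Ψ) w * ⟪U w, a⟫ := by
    have h := FluidPDE.integral_inner_laplacian_comm hU hW hWc
    have h1 : ∀ w, ⟪(Δ U) w, Ψ w • a⟫ = Ψ w * ⟪(Δ U) w, a⟫ := fun w => by
      rw [inner_smul_right]
    have h2 : ∀ w, ⟪U w, (Δ (fun w => Ψ w • a)) w⟫ = (Δ Ψ) w * ⟪U w, a⟫ := fun w => by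
      rw [laplacian_weight_smul_const hΨ, inner_smul_right]
    simp_rw [h1, h2] at h
    exact h
  rw [hcomm]
  refine abs_integral_le_of_support_subset hS
    (fun w hw => by rw [laplacian_eq_zero_of_notMem_tsupport fun h => hw (hΨS h), zero_mul])
    (fun w _ => ?_) hUS
  rw [abs_mul]
  calc |(Δ Ψ) w| * |⟪U w, a⟫| ≤ M₂ * (‖U w‖ * ‖a‖) :=
        mul_le_mul (hΔΨ w) (abs_real_inner_le_norm _ _) (abs_nonneg _) hM₂
    _ = ‖a‖ * M₂ * ‖U w‖ := by ring

omit [FiniteDimensional ℝ E] [MeasurableSpace E] [BorelSpace E] in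
/-- The derivative of `w ↦ Ψ(w) • a` applied to `h` is `(DΨ(w) h) • a`. [folklore] -/
private theorem fderiv_weight_smul_const_apply {Ψ : E → ℝ} (hΨ : Differentiable ℝ Ψ) (a w h : E) :
    fderiv ℝ (fun w => Ψ w • a) w h = (fderiv ℝ Ψ w h) • a := by
  rw [fderiv_smul_const (hΨ w), ContinuousLinearMap.smulRight_apply]

omit [MeasurableSpace E] [BorelSpace E] in
/-- The divergence of the identity field is the dimension. [folklore] -/
theorem divergence_id_eq_finrank (w : E) :
    VectorCalculus.divergence (fun x : E => x) w = Module.finrank ℝ E := by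
  rw [VectorCalculus.divergence, fderiv_fun_id]
  exact LinearMap.trace_id ℝ E

/-- **`|∫ Ψ ⟪DU(w) w, a⟫ dw| ≤ ‖a‖ (M₁ R + n M₀) ∫_S ‖U‖`** for `Ψ ∈ C¹_c` supported in `S`
with `|Ψ| ≤ M₀`, `‖DΨ‖ ≤ M₁`, `‖w‖ ≤ R` on `S`, `n = dim E`, and `U ∈ C¹` (the trilinear identity
`∫ ⟪(X·∇)U, W⟫ + ∫ ⟪U, (X·∇)W⟫ + ∫ (div X)⟪U, W⟫ = 0` with `X(w) = w`, `div X = n`,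
`W = Ψ a`). [folklore] -/
theorem abs_integral_weight_mul_inner_fderiv_apply_self_le (hS : MeasurableSet S) (hΨ : ContDiff ℝ 1 Ψ)
    (hΨc : HasCompactSupport Ψ) (hΨS : tsupport Ψ ⊆ S) {M₀ M₁ R : ℝ} (hM₀ : 0 ≤ M₀)
    (hM₁ : 0 ≤ M₁) (hR : 0 ≤ R) (hΨ0 : ∀ w, |Ψ w| ≤ M₀) (hΨ1 : ∀ w, ‖fderiv ℝ Ψ w‖ ≤ M₁)
    (hSR : ∀ w ∈ S, ‖w‖ ≤ R) (hU : ContDiff ℝ 1 U) (hUS : IntegrableOn (fun w => ‖U w‖) S)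
    (a : E) :
    |∫ w, Ψ w * ⟪fderiv ℝ U w w, a⟫| ≤
      ‖a‖ * (M₁ * R + Module.finrank ℝ E * M₀) * ∫ w in S, ‖U w‖ := by
  have hW : ContDiff ℝ 1 fun w => Ψ w • a := hΨ.smul contDiff_const
  have hWc : HasCompactSupport fun w => Ψ w • a := hΨc.smul_right (f' := fun _ : E => a)
  have hΨd : Differentiable ℝ Ψ := hΨ.differentiable one_ne_zero
  have key := integral_inner_convect_add_eq_zero (u := fun x : E => x) (v := U)
    (w := fun w => Ψ w • a) contDiff_id hU hW hWc
  -- identify the three terms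
  have h1 : ∀ w, ⟪convect (fun x : E => x) U w, Ψ w • a⟫ = Ψ w * ⟪fderiv ℝ U w w, a⟫ :=
    fun w => by rw [convect_apply, inner_smul_right]
  have h2 : ∀ w, ⟪U w, convect (fun x : E => x) (fun w => Ψ w • a) w⟫ =
      fderiv ℝ Ψ w w * ⟪U w, a⟫ := fun w => by
    rw [convect_apply, fderiv_weight_smul_const_apply hΨd, inner_smul_right]
  have h3 : ∀ w, VectorCalculus.divergence (fun x : E => x) w * ⟪U w, Ψ w • a⟫ =
      (Module.finrank ℝ E : ℝ) * (Ψ w * ⟪U w, a⟫) := fun w => by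
    rw [divergence_id_eq_finrank, inner_smul_right]
  simp_rw [h1, h2, h3] at key
  rw [integral_const_mul] at key
  have hI : ∫ w, Ψ w * ⟪fderiv ℝ U w w, a⟫ =
      -(∫ w, fderiv ℝ Ψ w w * ⟪U w, a⟫) - Module.finrank ℝ E * ∫ w, Ψ w * ⟪U w, a⟫ := by
    linarith
  -- bound the two terms
  have hB1 : |∫ w, fderiv ℝ Ψ w w * ⟪U w, a⟫| ≤ ‖a‖ * (M₁ * R) * ∫ w in S, ‖U w‖ := by
    refine abs_integral_le_of_support_subset hS (fun w hw => ?_) (fun w hw => ?_) hUS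
    · rw [fderiv_of_notMem_tsupport ℝ fun h => hw (hΨS h), _root_.zero_apply,
        zero_mul]
    · rw [abs_mul]
      have hD : |fderiv ℝ Ψ w w| ≤ M₁ * R := by
        rw [← Real.norm_eq_abs]
        calc ‖fderiv ℝ Ψ w w‖ ≤ ‖fderiv ℝ Ψ w‖ * ‖w‖ := ContinuousLinearMap.le_opNorm _ _
          _ ≤ M₁ * R := mul_le_mul (hΨ1 w) (hSR w hw) (norm_nonneg _) hM₁
      calc |fderiv ℝ Ψ w w| * |⟪U w, a⟫| ≤ (M₁ * R) * (‖U w‖ * ‖a‖) :=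
            mul_le_mul hD (abs_real_inner_le_norm _ _) (abs_nonneg _) (by positivity)
        _ = ‖a‖ * (M₁ * R) * ‖U w‖ := by ring
  have hB2 := abs_integral_weight_mul_inner_le hS hΨS hM₀ hΨ0 hUS a (U := U)
  have hI0 : 0 ≤ ∫ w in S, ‖U w‖ := integral_nonneg fun w => norm_nonneg _
  have hn : (0 : ℝ) ≤ Module.finrank ℝ E := Nat.cast_nonneg _
  rw [hI]
  calc |-(∫ w, fderiv ℝ Ψ w w * ⟪U w, a⟫) - Module.finrank ℝ E * ∫ w, Ψ w * ⟪U w, a⟫|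
      ≤ |∫ w, fderiv ℝ Ψ w w * ⟪U w, a⟫| + Module.finrank ℝ E * |∫ w, Ψ w * ⟪U w, a⟫| := by
        have := abs_sub (-(∫ w, fderiv ℝ Ψ w w * ⟪U w, a⟫))
          (Module.finrank ℝ E * ∫ w, Ψ w * ⟪U w, a⟫)
        rw [abs_neg, abs_mul, abs_of_nonneg hn] at this
        exact this
    _ ≤ ‖a‖ * (M₁ * R) * (∫ w in S, ‖U w‖) +
          Module.finrank ℝ E * (‖a‖ * M₀ * ∫ w in S, ‖U w‖) := by gcongr
    _ = ‖a‖ * (M₁ * R + Module.finrank ℝ E * M₀) * ∫ w in S, ‖U w‖ := by ring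

/-- **`|∫ Ψ ⟪(U·∇)U, a⟫| ≤ ‖a‖ M₁ ∫_S ‖U‖²`** for `Ψ ∈ C¹_c` supported in `S` with
`‖DΨ‖ ≤ M₁` and a divergence-free `U ∈ C¹` (the trilinear identity
`∫ ⟪(U·∇)U, W⟫ = −∫ ⟪U, (U·∇)W⟫`, `W = Ψ a`, `(U·∇)W = (DΨ U) a`). [folklore] -/
theorem abs_integral_weight_mul_inner_convect_le (hS : MeasurableSet S) (hΨ : ContDiff ℝ 1 Ψ)
    (hΨc : HasCompactSupport Ψ) (hΨS : tsupport Ψ ⊆ S) {M₁ : ℝ} (hM₁ : 0 ≤ M₁)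
    (hΨ1 : ∀ w, ‖fderiv ℝ Ψ w‖ ≤ M₁) (hU : ContDiff ℝ 1 U) (hdiv : VectorCalculus.IsDivFree U)
    (hUS : IntegrableOn (fun w => ‖U w‖ ^ 2) S) (a : E) :
    |∫ w, Ψ w * ⟪convect U U w, a⟫| ≤ ‖a‖ * M₁ * ∫ w in S, ‖U w‖ ^ 2 := by
  have hW : ContDiff ℝ 1 fun w => Ψ w • a := hΨ.smul contDiff_const
  have hWc : HasCompactSupport fun w => Ψ w • a := hΨc.smul_right (f' := fun _ : E => a)
  have hΨd : Differentiable ℝ Ψ := hΨ.differentiable one_ne_zero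
  have key := integral_inner_convect_add_eq_zero (u := U) (v := U) (w := fun w => Ψ w • a)
    hU hU hW hWc
  have h1 : ∀ w, ⟪convect U U w, Ψ w • a⟫ = Ψ w * ⟪convect U U w, a⟫ :=
    fun w => by rw [inner_smul_right]
  have h2 : ∀ w, ⟪U w, convect U (fun w => Ψ w • a) w⟫ = fderiv ℝ Ψ w (U w) * ⟪U w, a⟫ :=
    fun w => by rw [convect_apply, fderiv_weight_smul_const_apply hΨd, inner_smul_right]
  have h3 : ∀ w, VectorCalculus.divergence U w * ⟪U w, Ψ w • a⟫ = 0 := fun w => by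
    rw [hdiv w, zero_mul]
  simp_rw [h1, h2, h3] at key
  rw [integral_zero, add_zero] at key
  have hI : ∫ w, Ψ w * ⟪convect U U w, a⟫ = -∫ w, fderiv ℝ Ψ w (U w) * ⟪U w, a⟫ := by
    linarith
  rw [hI, abs_neg]
  refine abs_integral_le_of_support_subset hS (fun w hw => ?_) (fun w _ => ?_) hUS
  · rw [fderiv_of_notMem_tsupport ℝ fun h => hw (hΨS h), _root_.zero_apply,
      zero_mul]
  · rw [abs_mul]
    have hD : |fderiv ℝ Ψ w (U w)| ≤ M₁ * ‖U w‖ := by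
      rw [← Real.norm_eq_abs]
      calc ‖fderiv ℝ Ψ w (U w)‖ ≤ ‖fderiv ℝ Ψ w‖ * ‖U w‖ := ContinuousLinearMap.le_opNorm _ _
        _ ≤ M₁ * ‖U w‖ := by gcongr; exact hΨ1 w
    calc |fderiv ℝ Ψ w (U w)| * |⟪U w, a⟫| ≤ (M₁ * ‖U w‖) * (‖U w‖ * ‖a‖) :=
          mul_le_mul hD (abs_real_inner_le_norm _ _) (abs_nonneg _) (by positivity)
      _ = ‖a‖ * M₁ * ‖U w‖ ^ 2 := by ring

end Weighted

end Literature.Analysis.FluidPDE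

end
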